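import Literature.Geometry.DiscreteGeometry.ShellCensusReplayEscape
import HarnessLib

/-!
# Text format for extended census certificates

Topic `Literature/Geometry/DiscreteGeometry`; part 3 of 3 of the replayer extension
`ShellCensusReplayEscape.lean` (certificate stubs `stub_ffrC5NoOpenStar` / `stub_ffrC5NoFarFacet`
of crux `FiveFoldRationingR`, stmt-AtomisticToContinuum-18071, and request
`defn-ShellTrichotomyReplay` of stmt-18070): the decoder `ECensus.ofText` of an extended census
shipped as a string of integers (realistic certificates cannot be elaborated as terms), reusing
the tokenizer and the readers of `ShellCensusReplay.lean` (`Text.tokens`, `natAt`, `ratAt`,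
`readNats`, `readConstraints`, `decodeWitness`). Grammar (prefix, all tokens integers): that of
`Census.ofText` —

* census := `E` entry₁ … entry_E; entry := `L` (k l b)ᴸ tree (`b ∈ {0,1}`: far/bond);
* tree := `0 k l` tree tree (case) ∣ `1 L π₀…π_{L−1} j` (ref) ∣ `2` tree (frame)
  ∣ `3 axis num den` tree tree (split at `num/den`) ∣ `4` witness (empty)
  ∣ `5 pat (num den)⁹ L σ₀…σ_{L−1}` (accept) ∣ `6 pat a b c d s L σ₀…σ_{L−1}` (accept, quaternion)

— extended by `7 k` (torn) ∣ `8 k` (capped) ∣ `9 l prec` (aboveFacet). The degree window, the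
facet labels and the target constraint list are ARGUMENTS of `ECensus.check`, not data. Malformed
input decodes to the empty census, which fails every check. The decoder needs no correctness
proof (soundness is about whatever census it returns); `toyECensus_decode` reads the toy census of
part 1 back from its token form in the kernel. Intended use:
`ECensus.infeasible_of_check rfl (ECensus.ofText "<tokens>") (by native_decide)`.
-/

namespace Literature.Geometry.DiscreteGeometry

open Literature.Analysis.ValidatedNumerics

namespace ShellCensus

/-! ### The decoder -/

namespace Text

/-- Decode an extended tree at position `i` (`fuel` bounds the depth). [folklore] -/
def decodeETree (ts : Array ℤ) : ℕ → ℕ → Option (ETree × ℕ)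
  | 0, _ => none
  | fuel + 1, i =>
    let tag := intAt ts i
    if tag = 0 then
      match decodeETree ts fuel (i + 3) with
      | none => none
      | some (tb, j) =>
        match decodeETree ts fuel j with
        | none => none
        | some (tf, j') => some (.case (natAt ts (i + 1)) (natAt ts (i + 2)) tb tf, j')
    else if tag = 1 then
      let r := readNats ts (natAt ts (i + 1)) (i + 2)
      some (.ref r.1 (natAt ts r.2), r.2 + 1)
    else if tag = 2 then
      match decodeETree ts fuel (i + 1) with
      | none => none
      | some (t, j) => some (.frame t, j)
    else if tag = 3 then
      match decodeETree ts fuel (i + 4) with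
      | none => none
      | some (lo, j) =>
        match decodeETree ts fuel j with
        | none => none
        | some (hi, j') => some (.split (natAt ts (i + 1)) (ratAt ts (i + 2)) lo hi, j')
    else if tag = 4 then
      match decodeWitness ts (i + 1) with
      | none => none
      | some (w, j) => some (.empty w, j)
    else if tag = 5 then
      let M := (List.range 9).map fun e => ratAt ts (i + 2 + 2 * e)
      let r := readNats ts (natAt ts (i + 20)) (i + 21)
      some (.accept (natAt ts (i + 1)) M r.1, r.2)
    else if tag = 6 then
      let M := quatMat (intAt ts (i + 2)) (intAt ts (i + 3)) (intAt ts (i + 4)) (intAt ts (i + 5))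
        (intAt ts (i + 6))
      let r := readNats ts (natAt ts (i + 7)) (i + 8)
      some (.accept (natAt ts (i + 1)) M r.1, r.2)
    else if tag = 7 then some (.torn (natAt ts (i + 1)), i + 2)
    else if tag = 8 then some (.capped (natAt ts (i + 1)), i + 2)
    else if tag = 9 then some (.aboveFacet (natAt ts (i + 1)) (natAt ts (i + 2)), i + 3)
    else none

/-- Decode `count` extended entries from position `i`. [folklore] -/
def decodeEEntries (ts : Array ℤ) : ℕ → ℕ → Option ECensus
  | 0, _ => some []
  | count + 1, i =>
    let r := readConstraints ts (natAt ts i) (i + 1)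
    match decodeETree ts (ts.size + 1) r.2 with
    | none => none
    | some (t, j) =>
      match decodeEEntries ts count j with
      | none => none
      | some rest => some ((r.1, t) :: rest)

end Text

/-- **Decode an extended census from its text form** (the empty census on malformed input). [folklore] -/
def ECensus.ofText (s : String) : ECensus :=
  let ts := Text.tokens s
  (Text.decodeEEntries ts (Text.natAt ts 0) 1).getD []

/-- The token form of `toyECensus` (grammar of `ECensus.ofText`). [folklore] -/
def toyEToks : Array ℤ :=
  #[4, 1, 0, 1, 0, 2, 3, 5, 0, 1, 4, 6, 0, 1, 4, 6, 0, 1, 1, 0, 2, 0, 1, 4, 0, 2, 1, 3, 0,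
    1, 0, 3, 0, 1, 4, 0, 3, 2, 1, 0, 0, 0, 0, 1, 0, 0, 2, 0, 0, 3, 8, 0, 1, 4, 0, 1, 2, 3, 2,
    1, 4, 0, 1, 2, 3, 1, 0, 0, 2, 1, 4, 0, 1, 2, 3, 0, 7, 0]

/-- The decoder reads the token form of the toy census back (kernel evaluation). [folklore] -/
theorem toyECensus_decode :
    Text.decodeEEntries toyEToks (Text.natAt toyEToks 0) 1 = some toyECensus := by
  decide +kernel

end ShellCensus

end Literature.Geometry.DiscreteGeometry
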